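import Summits.KontsevichZagierPeriods.KontsevichZagierPeriods.Theses.SpheresForWalls
import Literature.NumberTheory.Transcendental.KZCubeRational

/-!
# `OneConicLayer` (stmt-KontsevichZagierPeriods-16402, route SpheresForWalls) — helper kit

Elementary analysis and algebra of the spherical densities `p(w)/(1+|w|²)ᵏ` on `ℝ²`
(`p ∈ ℚ[w₀, w₁]`), used by `Theorems/SpheresForWallsOneConicLayer.lean`:
`abs_aeval_le_sqrt_pow` (`|p(w)| ≤ M · √(1+|w|²)^{deg p}`); `integrable_aeval_div` (`p/(1+|w|²)ᴷ`
is integrable on `ℝ²` when `deg p + 3 ≤ 2K`, by comparison with the Japanese bracket);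
`totalDegree_pderiv_le`; `degree_add_four_le` — THE WEIGHT BOUND: if the inverted density
`K(w) = f(w/|w|²)|w|⁻⁴` extends continuously to `0` (the point at infinity of the sphere), every
monomial of `p` has degree `≤ 2k − 4` (top homogeneous component along rays); `monomial_decomp`,
`decomp` — THE HARMONIC DECOMPOSITION `p = P(w₀²+w₁²) + (w₀∂₁ − w₁∂₀)H`, `P ∈ ℚ[T]`, `deg H ≤ deg p`
(reduction formulae for `w₀ⁱw₁ʲ`). References: M. Kontsevich, D. Zagier, *Periods* (2001), §1.2.
-/

noncomputable section

open MeasureTheory Set Filter Topology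
open MvPolynomial

namespace Summit.KontsevichZagierPeriods.SpheresForWalls

namespace OneConic

/-! ### Growth of polynomials and integrability of spherical densities -/

/-- `|p(w)| ≤ M · √(1 + w₀² + w₁²)^{deg p}` for a rational polynomial `p` in two variables.
[folklore] -/
theorem abs_aeval_le_sqrt_pow (q : MvPolynomial (Fin 2) ℚ) :
    ∃ M : ℝ, 0 ≤ M ∧ ∀ w : Fin 2 → ℝ,
      |aeval w q| ≤ M * Real.sqrt (1 + (w 0 ^ 2 + w 1 ^ 2)) ^ q.totalDegree := by
  classical
  refine ⟨∑ d ∈ q.support, |(algebraMap ℚ ℝ) (coeff d q)|,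
    Finset.sum_nonneg fun _ _ => abs_nonneg _, fun w => ?_⟩
  set B : ℝ := 1 + (w 0 ^ 2 + w 1 ^ 2) with hB
  have hB1 : 1 ≤ Real.sqrt B := by
    rw [Real.one_le_sqrt]; nlinarith [sq_nonneg (w 0), sq_nonneg (w 1)]
  have hwi : ∀ i : Fin 2, |w i| ≤ Real.sqrt B := fun i => Real.abs_le_sqrt (by
    fin_cases i <;> simp [hB] <;> nlinarith [sq_nonneg (w 0), sq_nonneg (w 1)])
  have hmon : ∀ d ∈ q.support, |∏ i, w i ^ d i| ≤ Real.sqrt B ^ q.totalDegree := by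
    intro d hd
    have hdeg : d 0 + d 1 ≤ q.totalDegree := by
      have h := le_totalDegree hd
      rwa [Finsupp.sum_fintype _ _ (fun _ => rfl), Fin.sum_univ_two] at h
    rw [Fin.prod_univ_two, abs_mul, abs_pow, abs_pow]
    calc |w 0| ^ d 0 * |w 1| ^ d 1 ≤ Real.sqrt B ^ d 0 * Real.sqrt B ^ d 1 :=
          mul_le_mul (pow_le_pow_left₀ (abs_nonneg _) (hwi 0) _)
            (pow_le_pow_left₀ (abs_nonneg _) (hwi 1) _) (by positivity) (by positivity)
      _ = Real.sqrt B ^ (d 0 + d 1) := (pow_add _ _ _).symm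
      _ ≤ Real.sqrt B ^ q.totalDegree := pow_le_pow_right₀ hB1 hdeg
  rw [MvPolynomial.aeval_def, MvPolynomial.eval₂_eq', Finset.sum_mul]
  refine (Finset.abs_sum_le_sum_abs _ _).trans (Finset.sum_le_sum fun d hd => ?_)
  rw [abs_mul]
  exact mul_le_mul_of_nonneg_left (hmon d hd) (abs_nonneg _)

/-- The Japanese bracket `√(1 + w₀² + w₁²)⁻³` is integrable on `ℝ²` (the sup norm of `w ∈ ℝ²` is at
most its Euclidean norm). [folklore] -/
theorem integrable_inv_sqrt_cube :
    Integrable (fun w : Fin 2 → ℝ => (Real.sqrt (1 + (w 0 ^ 2 + w 1 ^ 2)) ^ 3)⁻¹) := by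
  have h := integrable_rpow_neg_one_add_norm_sq (E := Fin 2 → ℝ) (μ := volume) (r := 3)
    (by rw [Module.finrank_fin_fun]; norm_num)
  refine h.mono' (by fun_prop) (ae_of_all _ fun w => ?_)
  have hB : 0 < 1 + ‖w‖ ^ 2 := by positivity
  have hn : ‖w‖ ≤ Real.sqrt (w 0 ^ 2 + w 1 ^ 2) := by
    refine (pi_norm_le_iff_of_nonneg (Real.sqrt_nonneg _)).2 fun i => ?_
    rw [Real.norm_eq_abs]
    refine Real.abs_le_sqrt ?_
    fin_cases i <;> simp <;> nlinarith [sq_nonneg (w 0), sq_nonneg (w 1)]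
  have hle : 1 + ‖w‖ ^ 2 ≤ 1 + (w 0 ^ 2 + w 1 ^ 2) := by
    have h2 := pow_le_pow_left₀ (norm_nonneg _) hn 2
    rw [Real.sq_sqrt (by positivity)] at h2
    linarith
  rw [Real.norm_eq_abs, abs_inv, abs_pow, abs_of_nonneg (Real.sqrt_nonneg _),
    Real.sqrt_eq_rpow, ← Real.rpow_natCast, ← Real.rpow_mul (by positivity), ← Real.rpow_neg
    (by positivity)]
  norm_num
  rw [Real.rpow_neg hB.le, Real.rpow_neg (by positivity),
    inv_le_inv₀ (by positivity) (by positivity)]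
  exact Real.rpow_le_rpow hB.le hle (by norm_num)

/-- **Integrability of spherical densities**: `p(w)/(1 + w₀² + w₁²)ᴷ` is integrable on `ℝ²` when
`deg p + 3 ≤ 2K` (it is `O(|w|^{deg p − 2K})` with `deg p − 2K ≤ −3`). [folklore] -/
theorem integrable_aeval_div (q : MvPolynomial (Fin 2) ℚ) (K : ℕ) (hq : q.totalDegree + 3 ≤ 2 * K) :
    Integrable (fun w : Fin 2 → ℝ => aeval w q / (1 + (w 0 ^ 2 + w 1 ^ 2)) ^ K) := by
  obtain ⟨M, hM0, hM⟩ := abs_aeval_le_sqrt_pow q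
  refine (integrable_inv_sqrt_cube.const_mul M).mono' ?_ (ae_of_all _ fun w => ?_)
  · exact ((Literature.ModelTheory.ExponentialFields.continuous_aeval_real q).div
      (by fun_prop) fun w => by positivity).aestronglyMeasurable
  set B : ℝ := 1 + (w 0 ^ 2 + w 1 ^ 2) with hB
  have hB0 : 0 < B := by positivity
  have hS1 : 1 ≤ Real.sqrt B := by
    rw [Real.one_le_sqrt]; nlinarith [sq_nonneg (w 0), sq_nonneg (w 1)]
  have hBK : B ^ K = Real.sqrt B ^ (2 * K) := by rw [pow_mul, Real.sq_sqrt hB0.le]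
  rw [Real.norm_eq_abs, abs_div, abs_of_pos (pow_pos hB0 K), div_le_iff₀ (pow_pos hB0 K), hBK]
  calc |aeval w q| ≤ M * Real.sqrt B ^ q.totalDegree := hM w
    _ ≤ M * Real.sqrt B ^ (2 * K - 3) := by gcongr; omega
    _ = M * (Real.sqrt B ^ 3)⁻¹ * Real.sqrt B ^ (2 * K) := by
        have h3 : Real.sqrt B ^ (2 * K) = Real.sqrt B ^ 3 * Real.sqrt B ^ (2 * K - 3) := by
          rw [← pow_add]; congr 1; omega
        rw [h3, mul_assoc, inv_mul_cancel_left₀ (by positivity)]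

/-- A partial derivative lowers the total degree: `deg ∂ᵢq ≤ deg q − 1`. [folklore] -/
theorem totalDegree_pderiv_le (i : Fin 2) (q : MvPolynomial (Fin 2) ℚ) :
    (pderiv i q).totalDegree ≤ q.totalDegree - 1 := by
  rw [MvPolynomial.totalDegree]
  refine Finset.sup_le fun m hm => ?_
  have hc : coeff (m + Finsupp.single i 1) q ≠ 0 := by
    rw [mem_support_iff, coeff_pderiv] at hm
    exact fun h => hm (by simp [h])
  have h := le_totalDegree (mem_support_iff.2 hc)
  rw [Finsupp.sum_add_index' (fun _ => rfl) (fun _ _ _ => rfl), Finsupp.sum_single_index rfl] at h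
  omega

/-! ### The weight bound at the point at infinity -/

/-- Inversion in the unit circle is an involution off the origin: for `w = y/|y|²`,
`|w|² = 1/|y|²` and `w/|w|² = y`. [folklore] -/
theorem inversion_inv (y : Fin 2 → ℝ) (hy : y 0 ^ 2 + y 1 ^ 2 ≠ 0) :
    (y 0 / (y 0 ^ 2 + y 1 ^ 2)) ^ 2 + (y 1 / (y 0 ^ 2 + y 1 ^ 2)) ^ 2 = (y 0 ^ 2 + y 1 ^ 2)⁻¹ ∧
    (fun i => (y i / (y 0 ^ 2 + y 1 ^ 2)) /
      ((y 0 / (y 0 ^ 2 + y 1 ^ 2)) ^ 2 + (y 1 / (y 0 ^ 2 + y 1 ^ 2)) ^ 2)) = y := by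
  have h1 : (y 0 / (y 0 ^ 2 + y 1 ^ 2)) ^ 2 + (y 1 / (y 0 ^ 2 + y 1 ^ 2)) ^ 2 =
      (y 0 ^ 2 + y 1 ^ 2)⁻¹ := by field_simp
  exact ⟨h1, funext fun i => by rw [h1]; field_simp⟩

/-- Scaling along a ray: `p(t x)/tᴰ → p_D(x)` as `t → +∞`, where `D = deg p` and `p_D` is the top
homogeneous component of `p`. [folklore] -/
theorem tendsto_aeval_smul_div_pow (p : MvPolynomial (Fin 2) ℚ) (x : Fin 2 → ℝ) :
    Tendsto (fun t : ℝ => aeval (t • x) p / t ^ p.totalDegree) atTop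
      (𝓝 (aeval x (homogeneousComponent p.totalDegree p))) := by
  classical
  set D := p.totalDegree with hD
  have hdg : ∀ d : Fin 2 →₀ ℕ, d.degree = d 0 + d 1 := fun d => by
    rw [Finsupp.degree_eq_sum, Fin.sum_univ_two]
  have hexp : (fun t : ℝ => aeval (t • x) p / t ^ D) = fun t =>
      ∑ d ∈ p.support, (algebraMap ℚ ℝ (coeff d p) * ∏ i, x i ^ d i) * (t ^ d.degree / t ^ D) := by
    funext t
    rw [MvPolynomial.aeval_def, MvPolynomial.eval₂_eq', Finset.sum_div]
    refine Finset.sum_congr rfl fun d _ => ?_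
    simp only [Fin.prod_univ_two, Pi.smul_apply, smul_eq_mul, mul_pow, hdg, pow_add]
    ring
  have hlim : ∀ d ∈ p.support, Tendsto (fun t : ℝ => t ^ d.degree / t ^ D) atTop
      (𝓝 (if d.degree = D then 1 else 0)) := by
    intro d hd
    have hdeg : d.degree ≤ D := by
      have h := le_totalDegree hd
      rwa [Finsupp.sum_fintype _ _ (fun _ => rfl), Fin.sum_univ_two, ← hdg] at h
    rcases hdeg.eq_or_lt with h | h
    · rw [if_pos h, h]
      refine tendsto_const_nhds.congr' ?_
      filter_upwards [eventually_gt_atTop 0] with t ht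
      rw [div_self (pow_ne_zero _ ht.ne')]
    · rw [if_neg h.ne]
      have h0 : Tendsto (fun t : ℝ => (t ^ (D - d.degree))⁻¹) atTop (𝓝 0) :=
        tendsto_inv_atTop_zero.comp (tendsto_pow_atTop (by omega))
      refine h0.congr' ?_
      filter_upwards [eventually_gt_atTop 0] with t ht
      rw [pow_sub₀ _ ht.ne' hdeg, mul_inv_rev, inv_inv, div_eq_mul_inv]
  have hval : aeval x (homogeneousComponent D p) =
      ∑ d ∈ p.support, (algebraMap ℚ ℝ (coeff d p) * ∏ i, x i ^ d i) *
        (if d.degree = D then 1 else 0) := by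
    rw [homogeneousComponent_apply, map_sum, Finset.sum_filter]
    refine Finset.sum_congr rfl fun d _ => ?_
    split_ifs
    · simp [aeval_monomial, Finsupp.prod_pow]
    · simp
  rw [hexp, hval]
  exact tendsto_finsetSum _ fun d hd => tendsto_const_nhds.mul (hlim d hd)

/-- **The weight bound at infinity.** Let `K` be continuous on `ℝ²` and agree off the origin with
the spherical density `p/(1+|y|²)ᵏ` read in the inverted chart: `K(y/|y|²) = p(y)/(1+|y|²)ᵏ·|y|⁴`
for `y ≠ 0`. Then every monomial of `p` has degree `≤ 2k − 4`: `K` is bounded near `0`, so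
`|p(y)| = O(|y|^{2k−4})` at infinity, and along a ray `y = t x` the top homogeneous component
`p_D(x) = lim p(tx)/tᴰ` must vanish whenever `D > 2k − 4`. [folklore] -/
theorem degree_add_four_le (p : MvPolynomial (Fin 2) ℚ) (k : ℕ) (K : (Fin 2 → ℝ) → ℝ)
    (hKc : Continuous K)
    (hK : ∀ y : Fin 2 → ℝ, y 0 ^ 2 + y 1 ^ 2 ≠ 0 →
      K (fun i => y i / (y 0 ^ 2 + y 1 ^ 2)) =
        aeval y p / (1 + (y 0 ^ 2 + y 1 ^ 2)) ^ k * (y 0 ^ 2 + y 1 ^ 2) ^ 2) :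
    ∀ d ∈ p.support, (d 0 + d 1) + 4 ≤ 2 * k := by
  classical
  by_contra hcon
  push Not at hcon
  obtain ⟨d₀, hd₀, hlt⟩ := hcon
  set D := p.totalDegree with hD
  have hDlt : 2 * k < D + 4 := by
    have h := le_totalDegree hd₀
    rw [Finsupp.sum_fintype _ _ (fun _ => rfl), Fin.sum_univ_two] at h
    omega
  -- the top homogeneous component is non-zero
  set P := homogeneousComponent D p with hP
  have hPne : P ≠ 0 := by
    obtain ⟨dm, hdm, hdeg⟩ :=
      Finset.exists_mem_eq_sup p.support ⟨d₀, hd₀⟩ fun s => s.sum fun _ e => e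
    intro h0
    have hc : coeff dm P = coeff dm p := by
      rw [hP, coeff_homogeneousComponent, if_pos]
      rw [Finsupp.degree_eq_sum, ← Finsupp.sum_fintype dm (fun _ e => e) (fun _ => rfl), ← hdeg, hD,
        MvPolynomial.totalDegree]
    rw [h0, coeff_zero] at hc
    exact (mem_support_iff.1 hdm) hc.symm
  -- a real point with `P(x) ≠ 0` and `x₀ ≠ 0`
  have hPh : P.IsHomogeneous D := homogeneousComponent_isHomogeneous D p
  obtain ⟨x, hPx, hx0⟩ : ∃ x : Fin 2 → ℝ, aeval x P ≠ 0 ∧ x 0 ≠ 0 := by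
    set F : MvPolynomial (Fin 2) ℝ := MvPolynomial.map (algebraMap ℚ ℝ) (P * X 0) with hF
    have hFh : F.IsHomogeneous (D + 1) := (hPh.mul (isHomogeneous_X ℚ 0)).map _
    have hFne : F ≠ 0 := fun h => by
      have h' : P * X 0 = 0 := MvPolynomial.map_injective (algebraMap ℚ ℝ)
        (algebraMap ℚ ℝ).injective (by rw [← hF, h, map_zero])
      exact hPne (by simpa [X_ne_zero] using h')
    by_contra hall
    push Not at hall
    refine hFne (hFh.eq_zero_of_forall_eval_eq_zero fun x => ?_)
    have hxe : eval x F = aeval x P * x 0 := by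
      simp [hF, MvPolynomial.eval_map, MvPolynomial.aeval_def]
    by_cases h : aeval x P = 0
    · rw [hxe, h, zero_mul]
    · rw [hxe, hall x h, mul_zero]
  -- `K` is bounded on the unit ball
  obtain ⟨C, hC⟩ := (isCompact_closedBall (0 : Fin 2 → ℝ) 1).exists_bound_of_continuousOn
    hKc.continuousOn
  set N : ℝ := x 0 ^ 2 + x 1 ^ 2 with hN
  have hN0 : 0 < N := by
    have h : 0 < x 0 ^ 2 := by rw [← sq_abs]; exact pow_pos (abs_pos.2 hx0) 2
    rw [hN]; nlinarith [sq_nonneg (x 1)]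
  have hC0 : 0 ≤ C := (norm_nonneg _).trans (hC 0 (Metric.mem_closedBall_self zero_le_one))
  -- the two limits of `p(t x)/tᴰ` as `t → +∞`
  have hlim1 : Tendsto (fun t : ℝ => aeval (t • x) p / t ^ D) atTop (𝓝 (aeval x P)) :=
    tendsto_aeval_smul_div_pow p x
  have hlim2 : Tendsto (fun t : ℝ => aeval (t • x) p / t ^ D) atTop (𝓝 0) := by
    have hb : Tendsto (fun t : ℝ => C * 2 ^ k * N ^ k / N ^ 2 * t⁻¹) atTop (𝓝 0) := by
      have h := tendsto_inv_atTop_zero.const_mul (C * 2 ^ k * N ^ k / N ^ 2)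
      rwa [mul_zero] at h
    refine squeeze_zero_norm' ?_ hb
    filter_upwards [eventually_ge_atTop (1 : ℝ), eventually_ge_atTop N⁻¹,
      eventually_ge_atTop (|x 0| / N), eventually_ge_atTop (|x 1| / N)] with t ht1 htN htx0 htx1
    have ht0 : 0 < t := by linarith
    have htN1 : 1 ≤ t ^ 2 * N := by
      have h1 : 1 ≤ t * N := by
        have := mul_le_mul_of_nonneg_right htN hN0.le
        rwa [inv_mul_cancel₀ hN0.ne'] at this
      nlinarith
    have hx0' : |x 0| ≤ t * N := (div_le_iff₀ hN0).1 htx0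
    have hx1' : |x 1| ≤ t * N := (div_le_iff₀ hN0).1 htx1
    have hyS : (t • x) 0 ^ 2 + (t • x) 1 ^ 2 = t ^ 2 * N := by
      simp only [Pi.smul_apply, smul_eq_mul, hN]; ring
    have hyne : (t • x) 0 ^ 2 + (t • x) 1 ^ 2 ≠ 0 := by rw [hyS]; positivity
    have hball : (fun i => (t • x) i / ((t • x) 0 ^ 2 + (t • x) 1 ^ 2)) ∈
        Metric.closedBall (0 : Fin 2 → ℝ) 1 := by
      rw [mem_closedBall_zero_iff, pi_norm_le_iff_of_nonneg zero_le_one]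
      intro i
      have hden : (0 : ℝ) < t ^ 2 * N := by positivity
      show |(t • x) i / ((t • x) 0 ^ 2 + (t • x) 1 ^ 2)| ≤ 1
      rw [hyS, abs_div, abs_of_pos hden, div_le_one hden, Pi.smul_apply, smul_eq_mul, abs_mul,
        abs_of_pos ht0]
      fin_cases i
      · exact le_trans (mul_le_mul_of_nonneg_left hx0' ht0.le) (le_of_eq (by ring))
      · exact le_trans (mul_le_mul_of_nonneg_left hx1' ht0.le) (le_of_eq (by ring))
    have hCb := hC _ hball
    have hA : (0 : ℝ) < (1 + t ^ 2 * N) ^ k := by positivity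
    have hB : (0 : ℝ) < (t ^ 2 * N) ^ 2 := by positivity
    rw [hK _ hyne, hyS, Real.norm_eq_abs, abs_mul, abs_div, abs_of_pos hA, abs_of_pos hB,
      div_mul_eq_mul_div, div_le_iff₀ hA] at hCb
    -- `hCb : |p(tx)| (t²N)² ≤ C (1 + t²N)ᵏ`
    rw [norm_div, Real.norm_eq_abs, Real.norm_eq_abs, abs_of_pos (pow_pos ht0 D),
      div_le_iff₀ (pow_pos ht0 D)]
    have h2 : (1 + t ^ 2 * N) ^ k ≤ (2 * (t ^ 2 * N)) ^ k :=
      pow_le_pow_left₀ (by positivity) (by linarith) k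
    have h3 : t ^ (2 * k) ≤ t ^ (D + 3) := pow_le_pow_right₀ ht1 (by omega)
    calc |aeval (t • x) p| ≤ C * (1 + t ^ 2 * N) ^ k / (t ^ 2 * N) ^ 2 := by
          rw [le_div_iff₀ (by positivity)]; exact hCb
      _ ≤ C * (2 * (t ^ 2 * N)) ^ k / (t ^ 2 * N) ^ 2 := by gcongr
      _ = (C * 2 ^ k * N ^ k / N ^ 2) * (t ^ (2 * k) / t ^ 4) := by
          rw [mul_pow, mul_pow, ← pow_mul, mul_pow, show (t ^ 2) ^ 2 = t ^ 4 by ring]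
          field_simp
      _ ≤ (C * 2 ^ k * N ^ k / N ^ 2) * (t ^ (D + 3) / t ^ 4) := by gcongr
      _ = C * 2 ^ k * N ^ k / N ^ 2 * t⁻¹ * t ^ D := by
          rw [pow_add]
          field_simp
  exact hPx (tendsto_nhds_unique hlim1 hlim2)

/-! ### The harmonic decomposition of a polynomial -/

/-- **Reduction formulae.** Up to a positive integer factor, every monomial `w₀ⁱ w₁ʲ` is a
polynomial in `w₀² + w₁²` plus an angular derivative `(w₀∂₁ − w₁∂₀)H` with `deg H ≤ i + j`
(`w₀w₁ʲ = ∂_θ w₁ʲ⁺¹/(j+1)`, `j·w₁ʲ = (j−1)(w₀²+w₁²)w₁ʲ⁻² − ∂_θ(w₀w₁ʲ⁻¹)`, and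
`w₀ⁱ⁺²w₁ʲ = (w₀²+w₁²)w₀ⁱw₁ʲ − w₀ⁱw₁ʲ⁺²`, `∂_θ` commuting with `w₀² + w₁²`). [folklore] -/
theorem monomial_decomp : ∀ i j : ℕ, ∃ (m : ℕ) (P : Polynomial ℚ) (H : MvPolynomial (Fin 2) ℚ),
    (C (m : ℚ) + 1) * (X 0 ^ i * X 1 ^ j) =
      Polynomial.aeval (X 0 ^ 2 + X 1 ^ 2 : MvPolynomial (Fin 2) ℚ) P +
        (X 0 * pderiv 1 H - X 1 * pderiv 0 H) ∧
    H.totalDegree ≤ i + j := by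
  have h01 : pderiv 0 (X 1 : MvPolynomial (Fin 2) ℚ) = 0 := pderiv_X_of_ne (by decide)
  have h10 : pderiv 1 (X 0 : MvPolynomial (Fin 2) ℚ) = 0 := pderiv_X_of_ne (by decide)
  have h00 : pderiv 0 (X 0 : MvPolynomial (Fin 2) ℚ) = 1 := pderiv_X_self 0
  have h11 : pderiv 1 (X 1 : MvPolynomial (Fin 2) ℚ) = 1 := pderiv_X_self 1
  have hr2 : (X 0 ^ 2 + X 1 ^ 2 : MvPolynomial (Fin 2) ℚ).totalDegree ≤ 2 :=
    (totalDegree_add _ _).trans (max_le (totalDegree_X_pow _ _).le (totalDegree_X_pow _ _).le)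
  intro i
  induction i using Nat.twoStepInduction with
  | zero =>
    intro j
    induction j using Nat.twoStepInduction with
    | zero => exact ⟨0, 1, 0, by simp, by simp⟩
    | one =>
      refine ⟨0, 0, -X 0, ?_, by rw [totalDegree_neg, totalDegree_X]⟩
      simp [h10, h00]
    | more j hj _ =>
      obtain ⟨m, P, H, hid, hdeg⟩ := hj
      refine ⟨m * (j + 2) + j + 1, Polynomial.C ((j : ℚ) + 1) * Polynomial.X * P,
        C ((j : ℚ) + 1) * ((X 0 ^ 2 + X 1 ^ 2) * H) - C ((m : ℚ) + 1) * (X 0 * X 1 ^ (j + 1)),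
        ?_, ?_⟩
      · simp only [map_add, map_sub, map_mul, map_one, map_natCast, map_ofNat, Polynomial.aeval_X,
          Derivation.leibniz, Derivation.leibniz_pow, Derivation.map_one_eq_zero,
          Derivation.map_natCast, h01, h10, h00, h11, smul_eq_mul, nsmul_eq_mul,
          Nat.cast_add, Nat.cast_mul, Nat.cast_ofNat, Nat.cast_one, add_tsub_cancel_right, mul_one,
          mul_zero, add_zero, pow_zero, one_mul] at hid ⊢
        linear_combination (((j : MvPolynomial (Fin 2) ℚ) + 1) * (X 0 ^ 2 + X 1 ^ 2)) * hid
      · have h1 := totalDegree_sub (C ((j : ℚ) + 1) * ((X 0 ^ 2 + X 1 ^ 2) * H))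
          (C ((m : ℚ) + 1) * (X 0 * X 1 ^ (j + 1)))
        have h2 := totalDegree_mul (C ((j : ℚ) + 1)) ((X 0 ^ 2 + X 1 ^ 2) * H)
        have h3 := totalDegree_mul (X 0 ^ 2 + X 1 ^ 2 : MvPolynomial (Fin 2) ℚ) H
        have h4 := totalDegree_mul (C ((m : ℚ) + 1)) (X 0 * X 1 ^ (j + 1) : MvPolynomial (Fin 2) ℚ)
        have h5 := totalDegree_mul (X 0 : MvPolynomial (Fin 2) ℚ) (X 1 ^ (j + 1))
        rw [totalDegree_C] at h2 h4
        rw [totalDegree_X, totalDegree_X_pow] at h5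
        omega
  | one =>
    intro j
    refine ⟨j, 0, X 1 ^ (j + 1), ?_, by rw [totalDegree_X_pow]; omega⟩
    simp only [map_zero, map_natCast, Derivation.leibniz_pow, h01, h11, smul_eq_mul, nsmul_eq_mul,
      Nat.cast_add, Nat.cast_one, add_tsub_cancel_right, mul_one, mul_zero, zero_add, sub_zero,
      pow_one]
    ring
  | more i hi _ =>
    intro j
    obtain ⟨m₁, P₁, H₁, hid₁, hdeg₁⟩ := hi j
    obtain ⟨m₂, P₂, H₂, hid₂, hdeg₂⟩ := hi (j + 2)
    refine ⟨m₁ * m₂ + m₁ + m₂, Polynomial.C ((m₂ : ℚ) + 1) * Polynomial.X * P₁ -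
        Polynomial.C ((m₁ : ℚ) + 1) * P₂,
      C ((m₂ : ℚ) + 1) * ((X 0 ^ 2 + X 1 ^ 2) * H₁) - C ((m₁ : ℚ) + 1) * H₂, ?_, ?_⟩
    · simp only [map_add, map_sub, map_mul, map_one, map_natCast, Polynomial.aeval_X,
        Derivation.leibniz, Derivation.leibniz_pow, Derivation.map_one_eq_zero,
        Derivation.map_natCast, h01, h10, h00, h11, smul_eq_mul, nsmul_eq_mul,
        Nat.cast_add, Nat.cast_mul, mul_one, mul_zero, add_zero] at hid₁ hid₂ ⊢
      linear_combination (((m₂ : MvPolynomial (Fin 2) ℚ) + 1) * (X 0 ^ 2 + X 1 ^ 2)) * hid₁ -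
        ((m₁ : MvPolynomial (Fin 2) ℚ) + 1) * hid₂
    · have h1 := totalDegree_sub (C ((m₂ : ℚ) + 1) * ((X 0 ^ 2 + X 1 ^ 2) * H₁))
        (C ((m₁ : ℚ) + 1) * H₂)
      have h2 := totalDegree_mul (C ((m₂ : ℚ) + 1)) ((X 0 ^ 2 + X 1 ^ 2) * H₁)
      have h3 := totalDegree_mul (X 0 ^ 2 + X 1 ^ 2 : MvPolynomial (Fin 2) ℚ) H₁
      have h4 := totalDegree_mul (C ((m₁ : ℚ) + 1)) H₂
      rw [totalDegree_C] at h2 h4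
      omega

/-- **Harmonic decomposition.** Every `p ∈ ℚ[w₀, w₁]` is `P(w₀² + w₁²) + (w₀∂₁ − w₁∂₀)H` with
`P ∈ ℚ[T]`, `H ∈ ℚ[w₀, w₁]` and `deg H ≤ deg p` (sum of the reduction formulae over the monomials
of `p`). [folklore] -/
theorem decomp (p : MvPolynomial (Fin 2) ℚ) : ∃ (P : Polynomial ℚ) (H : MvPolynomial (Fin 2) ℚ),
    p = Polynomial.aeval (X 0 ^ 2 + X 1 ^ 2 : MvPolynomial (Fin 2) ℚ) P +
      (X 0 * pderiv 1 H - X 1 * pderiv 0 H) ∧ H.totalDegree ≤ p.totalDegree := by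
  classical
  choose m P H hPH hdeg using fun d : Fin 2 →₀ ℕ => monomial_decomp (d 0) (d 1)
  refine ⟨∑ d ∈ p.support, Polynomial.C (coeff d p / ((m d : ℚ) + 1)) * P d,
    ∑ d ∈ p.support, C (coeff d p / ((m d : ℚ) + 1)) * H d, ?_, ?_⟩
  · have hmono : ∀ d ∈ p.support, monomial d (coeff d p) =
        Polynomial.aeval (X 0 ^ 2 + X 1 ^ 2 : MvPolynomial (Fin 2) ℚ)
            (Polynomial.C (coeff d p / ((m d : ℚ) + 1)) * P d) +
          (X 0 * pderiv 1 (C (coeff d p / ((m d : ℚ) + 1)) * H d) -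
            X 1 * pderiv 0 (C (coeff d p / ((m d : ℚ) + 1)) * H d)) := by
      intro d _
      have hm : ((m d : ℚ) + 1) ≠ 0 := by positivity
      have e1 : monomial d (coeff d p) =
          C (coeff d p / ((m d : ℚ) + 1)) * ((C (m d : ℚ) + 1) * (X 0 ^ d 0 * X 1 ^ d 1)) := by
        rw [← mul_assoc, ← map_one C, ← map_add, ← map_mul, div_mul_cancel₀ _ hm, monomial_eq,
          Finsupp.prod_pow, Fin.prod_univ_two]
      rw [e1, hPH d]
      simp only [map_mul, Polynomial.aeval_C, MvPolynomial.algebraMap_eq, pderiv_C_mul]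
      ring
    conv_lhs => rw [p.as_sum, Finset.sum_congr rfl hmono]
    simp only [map_sum, Finset.mul_sum, Finset.sum_add_distrib, Finset.sum_sub_distrib]
  · refine (totalDegree_finsetSum _ _).trans (Finset.sup_le fun d hd => ?_)
    refine (totalDegree_mul _ _).trans ?_
    rw [totalDegree_C, zero_add]
    refine (hdeg d).trans ?_
    have h := le_totalDegree hd
    rwa [Finsupp.sum_fintype _ _ (fun _ => rfl), Fin.sum_univ_two] at h

end OneConic

end Summit.KontsevichZagierPeriods.SpheresForWalls

end
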